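import Literature.Computability.ImplicitComplexity.STASubstitution
import HarnessLib

/-!
# Confluence of β-reduction on the deterministic fragment of `STA₊`, and normal forms

Support file for the `PTIME` characterisation of `STA` (`STACapturesP`, GMR08 Thm. 3.5 + 3.9).
The acceptance convention of GMR08 Def. 3.8 is `s ∈ L ⟺ M s̲ →β* 0`; to compare it with a
Turing machine that computes ONE normal form of `M s̲` (soundness), and to show that a program
whose normal form is `1` does not also reduce to `0` (completeness), one needs that β-normal
forms of λ-terms are unique, i.e. the Church–Rosser theorem for `→β` (GMR08 §5: "the calculus
`Λ₊` equipped with `→βγ` is non confluent", but its sum-free part `Λ` with `→β` is).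

Contents (Tait–Martin-Löf / Takahashi's proof, de Bruijn form):

* `STA.Par` — parallel β-reduction `M ⇒ N` on `Λ₊`-terms, the sum `M + N` being treated as an
  inert binary constructor (NO choice steps), so that `⇒` is confluent on all of `Λ₊`;
* `STA.Term.cd` — Takahashi's complete development `M*`, and the triangle property
  `M ⇒ N → N ⇒ M*` (`Par.triangle`), whence the diamond property and confluence of `⇒*`;
* the bridge to `STA.Red`/`STA.Reduces` of `SoftTypeAssignment.lean`: `⇒ ⊆ →βγ*` always, and
  `→βγ ⊆ ⇒` on sum-free terms (a `γ`-choice needs a sum), so `Reduces` is confluent from every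
  sum-free term (`Reduces.church_rosser`);
* normal forms: `Term.IsNormal`, the data `0`, `1` are normal, normal forms of sum-free terms are
  unique (`Reduces.unique_normal`), in particular `M →* 0` and `M →* 1` exclude each other
  (`not_reduces_zero_one`).

## References

* [GaboardiMarionRonchidellarocca2008] M. Gaboardi, J.-Y. Marion, S. Ronchi Della Rocca, Soft
  Linear Logic and Polynomial Complexity Classes, ENTCS 205 (2008), Def. 3.1 (ii), Def. 3.8,
  Def. 5.2 and §5 (non-confluence of `→βγ`).
* M. Takahashi, Parallel reductions in λ-calculus, Inform. and Comput. 118 (1995) 120–127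
  (complete developments; folklore proof of Church–Rosser).
-/

namespace Literature.Computability.ImplicitComplexity

namespace STA

open Relation

/-! ### Parallel β-reduction -/

/-- Parallel β-reduction `M ⇒ N` (Tait–Martin-Löf): reduce any set of β-redexes of `M`
simultaneously; `sum` is an inert constructor here (no `γ`-choice), so `⇒` is confluent on all
terms. [folklore] -/
inductive Par : Term → Term → Prop
  | var (i : ℕ) : Par (.var i) (.var i)
  | app {M M' N N' : Term} (hM : Par M M') (hN : Par N N') : Par (.app M N) (.app M' N')
  | lam {M M' : Term} (hM : Par M M') : Par (.lam M) (.lam M')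
  | sum {M M' N N' : Term} (hM : Par M M') (hN : Par N N') : Par (.sum M N) (.sum M' N')
  | beta {M M' N N' : Term} (hM : Par M M') (hN : Par N N') :
      Par (.app (.lam M) N) (M'.subst0 N')

/-- `⇒` is reflexive. [folklore] -/
theorem Par.refl (M : Term) : Par M M := by
  induction M with
  | var i => exact Par.var i
  | app M N ihM ihN => exact Par.app ihM ihN
  | lam M ih => exact Par.lam ih
  | sum M N ihM ihN => exact Par.sum ihM ihN

/-- `⇒` is stable under renaming. [folklore] -/
theorem Par.rename {M M' : Term} (h : Par M M') (ρ : ℕ → ℕ) : Par (M.rename ρ) (M'.rename ρ) := by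
  induction h generalizing ρ with
  | var i => exact Par.var _
  | app _ _ ihM ihN => exact Par.app (ihM ρ) (ihN ρ)
  | lam _ ih => exact Par.lam (ih _)
  | sum _ _ ihM ihN => exact Par.sum (ihM ρ) (ihN ρ)
  | @beta M M' N N' _ _ ihM ihN =>
    rw [Term.subst0_rename]
    exact Par.beta (ihM _) (ihN ρ)

/-- `⇒` is stable under parallel substitution of `⇒`-related substitutions. [folklore] -/
theorem Par.substp {M M' : Term} (h : Par M M') {τ τ' : ℕ → Term} (hτ : ∀ i, Par (τ i) (τ' i)) :
    Par (M.substp τ) (M'.substp τ') := by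
  induction h generalizing τ τ' with
  | var i => exact hτ i
  | app _ _ ihM ihN => exact Par.app (ihM hτ) (ihN hτ)
  | lam _ ih =>
    refine Par.lam (ih fun i => ?_)
    cases i with
    | zero => exact Par.var 0
    | succ i => exact (hτ i).rename Nat.succ
  | sum _ _ ihM ihN => exact Par.sum (ihM hτ) (ihN hτ)
  | @beta M M' N N' _ _ ihM ihN =>
    rw [Term.subst0_substp]
    refine Par.beta (ihM fun i => ?_) (ihN hτ)
    cases i with
    | zero => exact Par.var 0
    | succ i => exact (hτ i).rename Nat.succ

/-- `⇒` is stable under β-substitution: `M ⇒ M'`, `N ⇒ N'` give `M[N/x] ⇒ M'[N'/x]`. [folklore] -/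
theorem Par.subst0 {M M' N N' : Term} (hM : Par M M') (hN : Par N N') :
    Par (M.subst0 N) (M'.subst0 N') := by
  rw [Term.subst0_eq_substp, Term.subst0_eq_substp]
  refine hM.substp fun i => ?_
  cases i with
  | zero => exact hN
  | succ i => exact Par.var i

/-! ### Complete developments and the triangle property -/

/-- Takahashi's complete development `M*`: contract every β-redex of `M`, inside out.
[folklore] -/
def Term.cd : Term → Term
  | .var i => .var i
  | .app (.var i) N => .app (.var i) (Term.cd N)
  | .app (.app M₁ M₂) N => .app (Term.cd (.app M₁ M₂)) (Term.cd N)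
  | .app (.lam M) N => (Term.cd M).subst0 (Term.cd N)
  | .app (.sum M₁ M₂) N => .app (Term.cd (.sum M₁ M₂)) (Term.cd N)
  | .lam M => .lam (Term.cd M)
  | .sum M N => .sum (Term.cd M) (Term.cd N)

/-- **Triangle property** (Takahashi): `M ⇒ N` implies `N ⇒ M*`. [folklore] -/
theorem Par.triangle {M N : Term} (h : Par M N) : Par N M.cd := by
  induction h with
  | var i => exact Par.var i
  | @app M M' N N' hM hN ihM ihN =>
    cases M with
    | var i =>
      cases hM
      exact Par.app (Par.var i) ihN
    | app M₁ M₂ => exact Par.app ihM ihN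
    | lam M₀ =>
      cases hM with
      | lam hM₀ =>
        cases ihM with
        | lam ih₀ => exact Par.beta ih₀ ihN
    | sum M₁ M₂ => exact Par.app ihM ihN
  | lam _ ih => exact Par.lam ih
  | sum _ _ ihM ihN => exact Par.sum ihM ihN
  | beta _ _ ihM ihN => exact Par.subst0 ihM ihN

/-- **Diamond property** of `⇒`. [folklore] -/
theorem Par.diamond {M N₁ N₂ : Term} (h₁ : Par M N₁) (h₂ : Par M N₂) :
    ∃ P, Par N₁ P ∧ Par N₂ P :=
  ⟨M.cd, h₁.triangle, h₂.triangle⟩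

/-- **Confluence of `⇒*`** (Church–Rosser for parallel reduction). [folklore] -/
theorem parStar_church_rosser {M N₁ N₂ : Term} (h₁ : ReflTransGen Par M N₁)
    (h₂ : ReflTransGen Par M N₂) : ∃ P, ReflTransGen Par N₁ P ∧ ReflTransGen Par N₂ P := by
  have := Relation.church_rosser (r := Par) (fun a b c hab hac => ?_) h₁ h₂
  · obtain ⟨P, hP₁, hP₂⟩ := this
    exact ⟨P, hP₁, hP₂⟩
  · obtain ⟨d, hbd, hcd⟩ := hab.diamond hac
    exact ⟨d, ReflGen.single hbd, ReflTransGen.single hcd⟩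

/-! ### Bridge to `→βγ` -/

/-- A parallel step is a `→βγ`-reduction sequence: `⇒ ⊆ →βγ*`. [folklore] -/
theorem Par.reduces {M N : Term} (h : Par M N) : Reduces M N := by
  induction h with
  | var i => exact ReflTransGen.refl
  | app _ _ ihM ihN => exact Reduces.app ihM ihN
  | lam _ ih => exact Reduces.lam ih
  | sum _ _ ihM ihN => exact Reduces.sum ihM ihN
  | @beta M M' N N' _ _ ihM ihN =>
    exact (Reduces.app (Reduces.lam ihM) ihN).tail (Red.beta M' N')

/-- `⇒* ⊆ →βγ*`. [folklore] -/
theorem parStar_reduces {M N : Term} (h : ReflTransGen Par M N) : Reduces M N := by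
  induction h with
  | refl => exact ReflTransGen.refl
  | tail _ hst ih => exact ih.trans hst.reduces

/-- On a sum-free term a `→βγ` step is a β-step, hence a parallel step. [folklore] -/
theorem Red.par {M N : Term} (h : Red M N) (hM : M.SumFree) : Par M N := by
  induction h with
  | beta M N => exact Par.beta (Par.refl M) (Par.refl N)
  | choiceL M N => exact hM.elim
  | choiceR M N => exact hM.elim
  | appL N _ ih => exact Par.app (ih hM.1) (Par.refl N)
  | appR M _ ih => exact Par.app (Par.refl M) (ih hM.2)
  | lam _ ih => exact Par.lam (ih hM)
  | sumL N _ _ => exact hM.elim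
  | sumR M _ _ => exact hM.elim

/-- From a sum-free term, `→βγ* ⊆ ⇒*`. [folklore] -/
theorem Reduces.parStar {M N : Term} (h : Reduces M N) (hM : M.SumFree) : ReflTransGen Par M N := by
  induction h with
  | refl => exact ReflTransGen.refl
  | @tail P Q hP hst ih => exact ih.tail (hst.par (Reduces.sumFree hP hM))

/-- **Church–Rosser for the deterministic fragment**: β-reduction sequences from a sum-free term
can be joined. [cite: GaboardiMarionRonchidellarocca2008, Def. 3.1 (ii)] -/
theorem Reduces.church_rosser {M N₁ N₂ : Term} (hM : M.SumFree) (h₁ : Reduces M N₁)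
    (h₂ : Reduces M N₂) : ∃ P, Reduces N₁ P ∧ Reduces N₂ P := by
  obtain ⟨P, hP₁, hP₂⟩ := parStar_church_rosser (h₁.parStar hM) (h₂.parStar hM)
  exact ⟨P, parStar_reduces hP₁, parStar_reduces hP₂⟩

/-! ### Normal forms -/

/-- `M` is `→βγ`-normal: no reduction step applies. [cite: GaboardiMarionRonchidellarocca2008, Def. 3.8, Def. 5.13] -/
def Term.IsNormal (M : Term) : Prop := ∀ N, ¬Red M N

/-- A variable is normal. [folklore] -/
theorem isNormal_var (i : ℕ) : (Term.var i).IsNormal := fun N h => by cases h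

/-- `λ M` is normal iff `M` is. [folklore] -/
theorem isNormal_lam_iff {M : Term} : (Term.lam M).IsNormal ↔ M.IsNormal := by
  constructor
  · intro h N hN
    exact h (.lam N) (Red.lam hN)
  · intro h N hN
    cases hN with
    | lam h' => exact h _ h'

/-- The boolean `0 ≐ λxy.x` is normal. [cite: GaboardiMarionRonchidellarocca2008, §3.2] -/
theorem isNormal_zero : zero.IsNormal :=
  isNormal_lam_iff.2 (isNormal_lam_iff.2 (isNormal_var 1))

/-- The boolean `1 ≐ λxy.y` is normal. [cite: GaboardiMarionRonchidellarocca2008, §3.2] -/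
theorem isNormal_one : one.IsNormal :=
  isNormal_lam_iff.2 (isNormal_lam_iff.2 (isNormal_var 0))

/-- A normal term reduces only to itself. [folklore] -/
theorem Reduces.eq_of_isNormal {M N : Term} (h : Reduces M N) (hM : M.IsNormal) : N = M := by
  induction h with
  | refl => rfl
  | tail _ hst ih =>
    subst ih
    exact (hM _ hst).elim

/-- `0 →βγ* N ↔ N = 0`. [folklore] -/
theorem reduces_zero_iff {N : Term} : Reduces zero N ↔ N = zero :=
  ⟨fun h => h.eq_of_isNormal isNormal_zero, fun h => h ▸ ReflTransGen.refl⟩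

/-- `1 →βγ* N ↔ N = 1`. [folklore] -/
theorem reduces_one_iff {N : Term} : Reduces one N ↔ N = one :=
  ⟨fun h => h.eq_of_isNormal isNormal_one, fun h => h ▸ ReflTransGen.refl⟩

/-- `0 ≠ 1` as terms. [folklore] -/
theorem zero_ne_one : zero ≠ one := by decide

/-- **Uniqueness of normal forms** on the deterministic fragment. [folklore] -/
theorem Reduces.unique_normal {M N₁ N₂ : Term} (hM : M.SumFree) (h₁ : Reduces M N₁)
    (h₂ : Reduces M N₂) (n₁ : N₁.IsNormal) (n₂ : N₂.IsNormal) : N₁ = N₂ := by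
  obtain ⟨P, hP₁, hP₂⟩ := Reduces.church_rosser hM h₁ h₂
  rw [← hP₁.eq_of_isNormal n₁, hP₂.eq_of_isNormal n₂]

/-- If a sum-free term reduces to the normal form `N`, then it reduces to `0` iff `N = 0`: the
answer of a deterministic program can be read off ANY normal form it reaches.
[cite: GaboardiMarionRonchidellarocca2008, Def. 3.8] -/
theorem reduces_zero_iff_of_normal {M N : Term} (hM : M.SumFree) (hN : Reduces M N)
    (n : N.IsNormal) : Reduces M zero ↔ N = zero := by
  constructor
  · intro h0
    exact Reduces.unique_normal hM hN h0 n isNormal_zero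
  · rintro rfl
    exact hN

/-- A sum-free term cannot reduce to both booleans. [cite: GaboardiMarionRonchidellarocca2008, §3.2, Def. 3.8] -/
theorem not_reduces_zero_one {M : Term} (hM : M.SumFree) (h₀ : Reduces M zero) (h₁ : Reduces M one) :
    False :=
  zero_ne_one (Reduces.unique_normal hM h₀ h₁ isNormal_zero isNormal_one)

/-- Reduction to `0` is invariant along reductions of a sum-free term: if `M →* M'` then
`M →* 0 ↔ M' →* 0`. [folklore] -/
theorem reduces_zero_iff_of_reduces {M M' : Term} (hM : M.SumFree) (h : Reduces M M') :
    Reduces M zero ↔ Reduces M' zero := by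
  constructor
  · intro h0
    obtain ⟨P, hP₁, hP₂⟩ := Reduces.church_rosser hM h h0
    rw [hP₂.eq_of_isNormal isNormal_zero] at hP₁
    exact hP₁
  · intro h0
    exact h.trans h0

end STA

end Literature.Computability.ImplicitComplexity
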